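import Summits.SmoothPoincare4.SmoothPoincare4.Theses.EntropyRung
import Summits.SmoothPoincare4.SmoothPoincare4.Theorems.SubcylindricalExistence.Negative.Window
import Literature.Geometry.Riemannian.PerelmanEntropyCutoff
import Literature.Geometry.Riemannian.BakryEmeryHeatFlow
import Literature.Geometry.Lorentzian.CurvatureSymmetries
import Literature.Geometry.Lorentzian.VolumePositivity
import Literature.Geometry.Lorentzian.VolumeProofs
import Summits.SmoothPoincare4.SmoothPoincare4.Theorems.EntropyRungSubcylindricalExistenceEntropyLocalisation
import HarnessLib

/-!
# Constants of the gluing: the core gradient bound, the capture radius, positivity of the volume,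
# and the elementary numerics (line `green-blowup-conformal-entropy`, crux
# `EntropyRung.SubcylindricalExistence`, stmt-SmoothPoincare4-10871; helpers for Stub D)

* `gradRatio_eq`, `exists_coreGradBound`: with the unit cap factor `ψ₁ = 4G/(4+G)` (smooth on all of
  `M`, `ψ₁(p) = 4`, `0 < ψ₁ < 4` off `p`) one has `G⁻²|∇G|²_g = (4/(ψ₁(4−ψ₁)))² |∇ψ₁|²_g` off `p`, hence
  a bound `Λ(S)` for `G⁻²|∇G|²_g` on `{x ≠ p, G x < S}` from the global extrema of `ψ₁`, `|∇ψ₁|²`.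
* `exists_capture`: some level `G₀` captures `{G ≥ G₀}` inside the open chart ball at `p`
  (`G` is bounded on the compact complement).
* `integral_pow_four_pos'`: `∫ ψ⁴ dV_g > 0` for a continuous positive `ψ` (the Riemannian measure is
  positive on open sets, `isOpenPosMeasure_riemannianMeasure`).
* numerics: `log 6 − 2 < 0`, `−2x ≤ log(1−x)` on `[0, ½]`, `√(C₁ + C₂K²) ≤ √C₁ + √C₂ K`.
Everything is proved; no definitions, no named facts.
-/

noncomputable section

set_option linter.dupNamespace false

open scoped Manifold ContDiff Topology
open Set Filter MeasureTheory
open Literature.Geometry.Lorentzian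

namespace Summit.SmoothPoincare4.SmoothPoincare4.Theorems

namespace GluingConstants

/-! ### Numerics -/

/-- `log 6 < 2` (`e² > 7.38 > 6`). [folklore] -/
theorem log_six_sub_two_neg : Real.log 6 - 2 < 0 := by
  have h1 : Real.log 6 < 2 := by
    rw [Real.log_lt_iff_lt_exp (by norm_num)]
    have he := Real.exp_one_gt_d9
    have : Real.exp 2 = Real.exp 1 * Real.exp 1 := by rw [← Real.exp_add]; norm_num
    rw [this]
    nlinarith
  linarith

/-- The target level `ν_cyl + ε` is negative for `ε ≤ 0.026`. [folklore] -/
theorem nuCyl_add_lt_zero {ε : ℝ} (hε : ε ≤ 0.026) :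
    Real.log 2 + Real.log Real.pi / 2 - 3 / 2 + ε < 0 := by
  have hm := Summit.SmoothPoincare4.Cruxes.SubcylindricalExistence.Negative.margin_gt
  have h6 := log_six_sub_two_neg
  linarith

/-- `-2x ≤ log(1 − x)` for `0 ≤ x ≤ ½`. [folklore] -/
theorem neg_two_mul_le_log_one_sub {x : ℝ} (hx0 : 0 ≤ x) (hx : x ≤ 1 / 2) :
    -2 * x ≤ Real.log (1 - x) := by
  have hpos : 0 < 1 - x := by linarith
  have h := Real.one_sub_inv_le_log_of_pos hpos
  have h2 : -2 * x ≤ 1 - (1 - x)⁻¹ := by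
    rw [show 1 - (1 - x)⁻¹ = -x / (1 - x) by field_simp; ring]
    rw [le_div_iff₀ hpos]
    nlinarith
  linarith

/-- `log(1 + x) ≤ x` for `0 ≤ x`. [folklore] -/
theorem log_one_add_le {x : ℝ} (hx : 0 ≤ x) : Real.log (1 + x) ≤ x := by
  have := Real.log_le_sub_one_of_pos (by linarith : 0 < 1 + x)
  linarith

/-- `√(C₁ + C₂ K²) ≤ √C₁ + √C₂ K` for `C₁, C₂, K ≥ 0`. [folklore] -/
theorem sqrt_quad_le {C₁ C₂ K : ℝ} (h₁ : 0 ≤ C₁) (h₂ : 0 ≤ C₂) (hK : 0 ≤ K) :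
    Real.sqrt (C₁ + C₂ * K ^ 2) ≤ Real.sqrt C₁ + Real.sqrt C₂ * K := by
  rw [Real.sqrt_le_left (by positivity)]
  have ha := Real.sq_sqrt h₁
  have hb := Real.sq_sqrt h₂
  nlinarith [Real.sqrt_nonneg C₁, Real.sqrt_nonneg C₂, mul_nonneg (Real.sqrt_nonneg C₂) hK]

/-! ### Geometry of the flat gauge: gradient bound, capture, volume -/

section Manifold

variable {M : Type} [TopologicalSpace M] [T2Space M] [SecondCountableTopology M]
  [ChartedSpace (EuclideanSpace ℝ (Fin 4)) M] [IsManifold (𝓡 4) ∞ M] [CompactSpace M]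
  [T3Space M] [MeasurableSpace M] [BorelSpace M]
  (g : PseudoRiemannianMetric (𝓡 4) ∞ (EuclideanSpace ℝ (Fin 4)) (TangentSpace (𝓡 4) : M → Type _))

omit [SecondCountableTopology M] [CompactSpace M] [T3Space M] [MeasurableSpace M] [BorelSpace M] in
/-- **`G⁻²|∇G|²` through the unit cap factor**: if `ψ₁` is differentiable at `x ≠ p` and
`ψ₁ = 4G/(4+G)` off `p` (`G > 0` there), then `G⁻²|∇G|²_g (x) = (4/(ψ₁(4−ψ₁)))² |∇ψ₁|²_g (x)`
(`G = 4ψ₁/(4−ψ₁)` near `x`, chain rule). [folklore] -/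
theorem gradRatio_eq {p : M} {G ψ₁ : M → ℝ} (hGpos : ∀ x, x ≠ p → 0 < G x)
    (hψ₁ : ContMDiff (𝓡 4) 𝓘(ℝ, ℝ) ∞ ψ₁) (hψG : ∀ x, x ≠ p → ψ₁ x = 4 * 1 * G x / (4 * 1 + G x))
    {x : M} (hx : x ≠ p) :
    (G x)⁻¹ ^ 2 * g.gradSq G x = (4 / (ψ₁ x * (4 - ψ₁ x))) ^ 2 * g.gradSq ψ₁ x := by
  have hG : ∀ y, y ≠ p → G y = 4 * ψ₁ y / (4 - ψ₁ y) := by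
    intro y hy
    have hGy := hGpos y hy
    rw [hψG y hy]
    field_simp
    ring
  have hψlt : ∀ y, y ≠ p → ψ₁ y < 4 := by
    intro y hy
    rw [hψG y hy]
    have hGy := hGpos y hy
    rw [div_lt_iff₀ (by positivity)]
    nlinarith
  have hψpos : ∀ y, y ≠ p → 0 < ψ₁ y := by
    intro y hy
    rw [hψG y hy]
    have hGy := hGpos y hy
    positivity
  have hev : G =ᶠ[𝓝 x] (fun t : ℝ ↦ 4 * t / (4 - t)) ∘ ψ₁ := by
    filter_upwards [isOpen_compl_singleton.mem_nhds hx] with y hy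
    exact hG y hy
  have hψx := hψlt x hx
  have hψx0 := hψpos x hx
  have hd : HasDerivAt (fun t : ℝ ↦ 4 * t / (4 - t)) (16 / (4 - ψ₁ x) ^ 2) (ψ₁ x) := by
    have h1 : HasDerivAt (fun t : ℝ ↦ 4 * t) 4 (ψ₁ x) := by simpa using (hasDerivAt_id (ψ₁ x)).const_mul 4
    have h2 : HasDerivAt (fun t : ℝ ↦ 4 - t) (-1) (ψ₁ x) := by simpa using (hasDerivAt_id (ψ₁ x)).const_sub 4
    have h := h1.div h2 (by linarith)
    have h4' : (4 : ℝ) - ψ₁ x ≠ 0 := by linarith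
    refine h.congr_deriv ?_
    field_simp
    ring
  have hψd : MDifferentiableAt (𝓡 4) 𝓘(ℝ, ℝ) ψ₁ x := (hψ₁ x).mdifferentiableAt (by simp)
  rw [show g.gradSq G x = g.gradSq ((fun t : ℝ ↦ 4 * t / (4 - t)) ∘ ψ₁) x by
    simp only [PseudoRiemannianMetric.gradSq, mvfderiv_congr_of_eventuallyEq hev],
    g.gradSq_real_comp hd hψd, hG x hx]
  have h4 : (4 - ψ₁ x) ≠ 0 := by linarith
  field_simp
  ring

omit [SecondCountableTopology M] [T3Space M] [MeasurableSpace M] [BorelSpace M] in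
/-- **The core gradient bound**: a `Λ ≥ 0` with `G⁻²|∇G|²_g ≤ Λ` on `{x ≠ p, G x < S}` (`S > 0`),
from the global minimum of the unit cap factor `ψ₁ > 0` and the global maximum of `|∇ψ₁|²` on the
compact `M`. [folklore] -/
theorem exists_coreGradBound [Nonempty M] (hg : g.IsRiemannian) {p : M} {G ψ₁ : M → ℝ}
    (hGpos : ∀ x, x ≠ p → 0 < G x)
    (hψ₁ : ContMDiff (𝓡 4) 𝓘(ℝ, ℝ) ∞ ψ₁) (hψ₁pos : ∀ x, 0 < ψ₁ x)
    (hψG : ∀ x, x ≠ p → ψ₁ x = 4 * 1 * G x / (4 * 1 + G x)) {S : ℝ} (hS : 0 < S) :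
    ∃ Λ : ℝ, 0 ≤ Λ ∧ ∀ x, x ≠ p → G x < S → (G x)⁻¹ ^ 2 * g.gradSq G x ≤ Λ := by
  -- global extrema
  obtain ⟨xm, -, hxm⟩ := isCompact_univ.exists_isMinOn univ_nonempty hψ₁.continuous.continuousOn
  have hGc : Continuous (g.gradSq ψ₁) := (Literature.Geometry.Riemannian.contMDiff_gradSq g hψ₁).continuous
  obtain ⟨Λ₁, hΛ₁⟩ := isCompact_univ.exists_bound_of_continuousOn hGc.continuousOn
  set m : ℝ := ψ₁ xm with hm
  have hm0 : 0 < m := hψ₁pos xm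
  have hmle : ∀ x, m ≤ ψ₁ x := fun x ↦ hxm (mem_univ x)
  refine ⟨(4 / (m * (16 / (4 + S)))) ^ 2 * max Λ₁ 0, mul_nonneg (sq_nonneg _) (le_max_right _ _),
    fun x hx hGx ↦ ?_⟩
  rw [gradRatio_eq g hGpos hψ₁ hψG hx]
  have hGx0 := hGpos x hx
  have hψx : ψ₁ x = 4 * G x / (4 + G x) := by rw [hψG x hx]; ring
  have hden : 16 / (4 + S) ≤ 4 - ψ₁ x := by
    rw [hψx, show 4 - 4 * G x / (4 + G x) = 16 / (4 + G x) by field_simp; ring]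
    exact div_le_div_of_nonneg_left (by norm_num) (by positivity) (by linarith)
  have hden0 : 0 < 16 / (4 + S) := by positivity
  have hprod : m * (16 / (4 + S)) ≤ ψ₁ x * (4 - ψ₁ x) :=
    mul_le_mul (hmle x) hden hden0.le (hψ₁pos x).le
  have hprod0 : 0 < m * (16 / (4 + S)) := mul_pos hm0 hden0
  have h1 : (4 / (ψ₁ x * (4 - ψ₁ x))) ^ 2 ≤ (4 / (m * (16 / (4 + S)))) ^ 2 := by
    apply pow_le_pow_left₀ (div_nonneg (by norm_num) (mul_nonneg (hψ₁pos x).le (hden0.le.trans hden)))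
    exact div_le_div_of_nonneg_left (by norm_num) hprod0 hprod
  have h2 : g.gradSq ψ₁ x ≤ max Λ₁ 0 := by
    have := hΛ₁ x (mem_univ x)
    rw [Real.norm_eq_abs] at this
    exact (le_abs_self _).trans (this.trans (le_max_left _ _))
  exact mul_le_mul h1 h2 (g.gradSq_nonneg hg ψ₁ x) (by positivity)

omit [T2Space M] [SecondCountableTopology M] [T3Space M] [MeasurableSpace M] [BorelSpace M]
  [IsManifold (𝓡 4) ∞ M] in
/-- **Capture**: some level `G₀` such that every `x ≠ p` with `G x ≥ G₀` lies in the open chart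
ball `{x ∈ φ.source, φ x ∈ B(φ p, r)}` (`G` is continuous off `p`, hence bounded on the compact
complement of that open neighbourhood of `p`). [folklore] -/
theorem exists_capture {p : M} {G : M → ℝ} (hGs : ContinuousOn G {p}ᶜ) {r : ℝ} (hr : 0 < r) :
    ∃ G₀ : ℝ, ∀ x, x ≠ p → G₀ ≤ G x →
      x ∈ (extChartAt (𝓡 4) p).source ∧ extChartAt (𝓡 4) p x ∈ Metric.ball (extChartAt (𝓡 4) p p) r := by
  set U : Set M := {x | x ∈ (extChartAt (𝓡 4) p).source ∧
    extChartAt (𝓡 4) p x ∈ Metric.ball (extChartAt (𝓡 4) p p) r} with hU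
  have hUopen : IsOpen U :=
    (continuousOn_extChartAt p).isOpen_inter_preimage (isOpen_extChartAt_source p)
      (Metric.isOpen_ball : IsOpen (Metric.ball (extChartAt (𝓡 4) p p) r))
  have hpU : p ∈ U := ⟨mem_extChartAt_source p, Metric.mem_ball_self hr⟩
  have hK : IsCompact Uᶜ := hUopen.isClosed_compl.isCompact
  have hKp : Uᶜ ⊆ {p}ᶜ := fun x hx hxp ↦ hx (by rw [mem_singleton_iff.1 hxp]; exact hpU)
  obtain ⟨B, hB⟩ := hK.exists_bound_of_continuousOn (hGs.mono hKp)
  refine ⟨B + 1, fun x _ hGx ↦ ?_⟩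
  by_contra hxU
  have := hB x hxU
  rw [Real.norm_eq_abs] at this
  linarith [le_abs_self (G x)]

omit [T2Space M] [SecondCountableTopology M] in
/-- `∫ ψ⁴ dV_g > 0` for a continuous positive `ψ` on a (nonempty) closed Riemannian manifold. [folklore] -/
theorem integral_pow_four_pos' [Nonempty M] (hg : g.IsRiemannian) {ψ : M → ℝ} (hψ : Continuous ψ)
    (hψpos : ∀ x, 0 < ψ x) :
    0 < ∫ x, ψ x ^ 4 ∂(riemannianMeasure (g.toContMDiffRiemannianMetric hg)) := by
  set μ : Measure M := riemannianMeasure (g.toContMDiffRiemannianMetric hg) with hμ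
  haveI : μ.IsOpenPosMeasure := isOpenPosMeasure_riemannianMeasure _
  haveI : IsFiniteMeasure μ := isFiniteMeasure_riemannianMeasure _
  have hc : Continuous fun x ↦ ψ x ^ 4 := hψ.pow 4
  have hnn : 0 ≤ fun x ↦ ψ x ^ 4 := fun x ↦ by positivity
  rw [integral_pos_iff_support_of_nonneg hnn
    (EntropyLocalisation.integrable_of_continuous g hg hc)]
  have hsupp : Function.support (fun x ↦ ψ x ^ 4) = univ := by
    ext x; simp [(hψpos x).ne']
  rw [hsupp]
  exact isOpen_univ.measure_pos μ univ_nonempty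

end Manifold

end GluingConstants

/-- **The core gradient bound** (registered sub-goal `gluingCoreGradBound` of Stub D of line
`green-blowup-conformal-entropy`; ∀-form of `GluingConstants.exists_coreGradBound`): with the unit
cap factor `ψ₁ = 4G/(4+G)` smooth on `M`, `G⁻²|∇G|²_g` is bounded on `{x ≠ p, G x < S}`. [folklore] -/
theorem gluingCoreGradBound :
    ∀ (M : Type) [TopologicalSpace M] [T2Space M] [SecondCountableTopology M]
      [ChartedSpace (EuclideanSpace ℝ (Fin 4)) M] [IsManifold (𝓡 4) ∞ M] [CompactSpace M]
      [T3Space M] [MeasurableSpace M] [BorelSpace M] [Nonempty M]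
      (g : PseudoRiemannianMetric (𝓡 4) ∞ (EuclideanSpace ℝ (Fin 4)) (TangentSpace (𝓡 4) : M → Type _)),
      g.IsRiemannian → ∀ (p : M) (G ψ₁ : M → ℝ), (∀ x, x ≠ p → 0 < G x) →
      ContMDiff (𝓡 4) 𝓘(ℝ, ℝ) ∞ ψ₁ → (∀ x, 0 < ψ₁ x) →
      (∀ x, x ≠ p → ψ₁ x = 4 * 1 * G x / (4 * 1 + G x)) → ∀ (S : ℝ), 0 < S →
      ∃ Λ : ℝ, 0 ≤ Λ ∧ ∀ x, x ≠ p → G x < S → (G x)⁻¹ ^ 2 * g.gradSq G x ≤ Λ := by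
  intro M _ _ _ _ _ _ _ _ _ _ g hg p G ψ₁ hGpos hψ₁ hψ₁pos hψG S hS
  exact GluingConstants.exists_coreGradBound g hg hGpos hψ₁ hψ₁pos hψG hS

end Summit.SmoothPoincare4.SmoothPoincare4.Theorems

end
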